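import Summits.QuantumFields.BalabanUV.Beta.FP.PeriodisedWardOrderOneStoreys
import Summits.QuantumFields.BalabanUV.Beta.FP.TorusCompositeCovarianceSym
import Summits.QuantumFields.BalabanUV.Beta.FP.TorusCompositeCompanionSumG

/-!
# `BalabanUV.Beta.FP.PeriodisedWardOrderOneTowerStep` — road «FP» for binder row D1, ROUTE T (β1), the OWNER d1-p3's R-FP-74 (b) + W-FP-33-3 («GO — type the
# generic closing now; the companion sum is leaf-06's reviewed `def` `TorusCompositeCompanionSumG.compSumSym`, companions indexed BY THE TORUS THEY LIVE ON»):
# **THE TOWER's `a1` ROW, STOREY BY STOREY — PART 1: THE TWO CASES OF THE TOP-PEEL INDUCTION** (no `def` here; the one object is leaf-06's `compSumSym`).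
# * §1 small [folklore] lemmas: the storey potentials `z ↦ φ_e (itRoot n (wrapPt M z))` (a family of potentials on the finest sites read from the top at leaf-02's
#   iterated centred root of the box representative) — periodicity and the top-peel recursion `… (n+1) [M] z = … n [fine Lc M] (Lc•z + ρ_c)` (`…Storeys.itRoot_wrapPt_succ`);
#   `apply_wrapPt_of_periodic`; `kappa_zero_eq_prod` (the covariance scales down the tower); `assembly_cancel` (the step's last bookkeeping).
# * §2a `tower_a1_row_base` — depth `0` (no companion, `compSumSym … 0 = 0`): Wilson half (`…Potentials.torus_a1_wilson_potentials`) + the bottom Λ table's reading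
#   split (`…Storeys.torus_lamFamily_mul_grad_potentials_split`, `κ = 1`) + (K1) ⟹ the row IS the bottom Λ table's raw endpoint readings.
# * §2b `tower_a1_row_step` — depth `n+1` from depth `n` over `fine Lc M` (hypothesis `ih`; `compSumSym_succ` spelled top-peeled): the IH's top remainder regroups
#   through the LITERAL top rows `QstepSym Lc M (lev 1)` (`…Storeys.rawRem_eq_neg_smul_transpose_mul`), the top companion `G M` (= the top storey's Λ-family, `hG0`)
#   reads leaf-02's composite covariance image of the columns (`TorusCompositeCovarianceSym.compRowsSym_mul_tgrad_mul` + `…Potentials.tgrad_ff_mul_eq_of_grad`; scale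
#   `κ 0` by `kappa_zero_eq_prod`) split as «diagonal + raw remainder» at the storey potentials of depth `n+1`, and ONE (K1′)-type link cancels the diagonal against
#   the regrouped IH remainder — the new right-hand side is the top companion's raw remainder.
# The induction and the record's corollary are `PeriodisedWardOrderOneTowerClosing`.  Columns throughout: the gradients of an ARBITRARY family of periodic
# potentials on the finest torus.  [folklore] bookkeeping BY NAME over OUR typed objects (leaf-06's `towerTorus ∕ QstepSym ∕ compRowsSym ∕ compSumSym`, leaf-02's
# `itRoot`); no `def`, no `def … : Prop`, nothing cited, 0 sorry; 0 estimates; discharges NO row of the door by itself (the (K1) row, the links and the companions'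
# identifications `hG` are DISPLAYED hypotheses — the nested column's KKT letters and the row's tables: R-FP-74 (b)(c), Q-FP-33-1).

HONEST DEPENDENCY (page 1, mandatory): continuum YM on T⁴ ⇐ BetaPertH ∧ nine spine estimates (0/9 proved); BetaPertH ⇐ (D1) ∧ (D4) ∧ CAP+tail;
G-an2-4 gates asym, D1 and NE2/3/4.  HONEST FRAMING (cell contract, verbatim): «discharging `BetaPertH` makes Bałaban's UV stability UNCONDITIONAL —
a real constructive-QFT result; it is NOT the continuum limit and NOT the Clay problem.»  ABSOLUTE RULE (cell charter, verbatim): «No internally-minted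
statement may enter as a cited fact. Every hypothesis is either kernel-proved in this package or a verbatim quotation of a PUBLISHED theorem with page
reference. The manuscript(s) under audit are NOT citable for their own disputed steps — they are the thing under adjudication; programme-internal
(2001/route/tribunal) claims are never citable.»  Nothing of Bałaban's ∕ the dictionary's asserted; 0∕4 row-D1 binders (hW, hR, D1Tel, D1Rep); ROOT M‴ p325680
untouched; NOT (C1), NOT (T-ID), NOT SDF, NOT D1, NEVER «G-an2-4 closed», NOT BetaPertH, NOT continuum, NOT Clay.  «not in print; our bookkeeping».
Unit `b2b-balaban-beta-d1-formalise-leaf-05` (gen 44), 2026-08-24; no existing file touched.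
-/

noncomputable section

namespace Summit.QuantumFields.BalabanUV.Beta.FP.PeriodisedWardOrderOneTowerStep

open scoped BigOperators Matrix
open Finset Matrix
open Literature.MathematicalPhysics.QuantumFieldTheory.Balaban1983to89
open Literature.MathematicalPhysics.QuantumFieldTheory.Balaban1983to89.Beta
open B4TorusKernel.MultiPeriod (translate translate_apply)
open B5Prop11Plancherel (fine)
open B6Lemma24Torus (pbox mem_pbox wrap wrap_eq_self wrap_congr)
open ExpKernelCalculus (MKer)
open AffineAveraging (Site box toSite unitVec)
open AveragingContoursRooted (ctr ctrOff ctrOff_mem_box)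
open OneStepResolventKernel (Fib)
open InterLevelTransport (SLam)
open StepJetData (wilsonA)
open Summit.QuantumFields.BalabanUV.Beta.SymAveragingHessianCounts (symHessFFAt symLinKerAt)
open Summit.QuantumFields.BalabanUV.Beta.BorderedHessian (bhKStepAt stepScale)
open Summit.QuantumFields.BalabanUV.Beta.DshAn1 (Dsh)
open Summit.QuantumFields.BalabanUV.Beta.SymShiftedSpread (bhKStepSh)
open Summit.QuantumFields.BalabanUV.Beta.FP.KernelPeriodisationFib (Idx perF perF_apply perZ perZ_apply)
open Summit.QuantumFields.BalabanUV.Beta.FP.KernelPeriodisationFibLoc (dper)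
open Summit.QuantumFields.BalabanUV.Beta.FP.TorusGaugeCovariance (tdelta tgrad tgrad_inl)
open Summit.QuantumFields.BalabanUV.Beta.FP.TorusGaugeCovarianceCoarse (coarsePt coarsePt_coe)
open Summit.QuantumFields.BalabanUV.Beta.FP.TorusGaugeCovariancePairing (wrapPt wrapPt_coe wrapPt_of_mem)
open Summit.QuantumFields.BalabanUV.Beta.FP.TorusCompositeObjects (towerTorus towerTorus_apply towerTorus_zero)
open Summit.QuantumFields.BalabanUV.Beta.FP.TorusCompositeObjectsG (QstepSym compRowsSym compRowsSym_zero compRowsSym_succ)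
open Summit.QuantumFields.BalabanUV.Beta.FP.TorusCompositeCovariance (rootPt rootPt_coe itRoot itRoot_zero itRoot_succ)
open Summit.QuantumFields.BalabanUV.Beta.FP.TorusCompositeCovarianceSym (compRowsSym_mul_tgrad_mul)
open Summit.QuantumFields.BalabanUV.Beta.FP.TorusCompositeCompanionSumG (onTower compSumG compSumSym compSumSym_zero compSumSym_succ)
open Summit.QuantumFields.BalabanUV.Beta.FP.PeriodisedWardOrderOnePotentials (torus_a1_wilson_potentials tgrad_ff_mul_eq_of_grad wrapPt_translate wrapPt_coe_eq)
open Summit.QuantumFields.BalabanUV.Beta.FP.PeriodisedWardOrderOneStoreys (torus_lamFamily_mul_grad_potentials_split rawRem_eq_neg_smul_transpose_mul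
  itRoot_wrapPt_succ)

variable {d : ℕ} (Lc : ℕ) [NeZero Lc] (N : ℕ)

/-! ## §1 The storey potentials (read at leaf-02's iterated centred roots) and three small bookkeeping lemmas -/

omit [NeZero Lc] in
/-- [folklore] the box representative is a period translate: a periodic potential reads the same at `wrapPt M z` and at `z`. -/
theorem apply_wrapPt_of_periodic (M : Fin (d + 1) → ℕ) [∀ μ, NeZero (M μ)] {φ : Site (d + 1) → ℝ} (hφ : ∀ z m, φ (translate M z m) = φ z)
    (z : Site (d + 1)) : φ ((wrapPt M z : ↥(pbox M)) : Site (d + 1)) = φ z := by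
  have e : ((wrapPt M z : ↥(pbox M)) : Site (d + 1)) = translate M z (fun i => -(z i / (M i : ℤ))) := by
    funext i
    rw [wrapPt_coe, translate_apply]
    simp only [wrap]
    rw [Int.emod_def]
    ring
  rw [e, hφ]

/-- **the storey potentials' top-peel recursion** (`…Storeys.itRoot_wrapPt_succ`): reading `φ_e` at the `(n+1)`-fold iterated centred root (top `M`) of the
representative of `z` = reading it at the `n`-fold one (top `fine Lc M`) of the representative of `Lc•z + ρ_c`. -/
theorem itRootPot_succ (hc : ctrOff (d + 1) Lc ∈ box (d + 1) Lc) (M : Fin (d + 1) → ℕ) [∀ μ, NeZero (M μ)] (n : ℕ) {γ : Type*}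
    (φ : γ → Site (d + 1) → ℝ) (e : γ) (z : Site (d + 1)) :
    φ e ((itRoot Lc (M) (fun _ => ctrOff (d + 1) Lc) (fun _ => hc) (n + 1) (wrapPt (M) z) : ↥(pbox (towerTorus Lc (M) (n + 1)))) : Site (d + 1))
      = φ e ((itRoot Lc (fine Lc M) (fun _ => ctrOff (d + 1) Lc) (fun _ => hc) n (wrapPt (fine Lc M) ((Lc : ℤ) • z + toSite (ctrOff (d + 1) Lc))) : ↥(pbox (towerTorus Lc (fine Lc M) n))) : Site (d + 1)) := by
  rw [itRoot_wrapPt_succ]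

/-- the same at a shifted point `z + v` (endpoint form `Lc•z + ρ_c + Lc•v`). -/
theorem itRootPot_succ_add (hc : ctrOff (d + 1) Lc ∈ box (d + 1) Lc) (M : Fin (d + 1) → ℕ) [∀ μ, NeZero (M μ)] (n : ℕ) {γ : Type*}
    (φ : γ → Site (d + 1) → ℝ) (e : γ) (z v : Site (d + 1)) :
    φ e ((itRoot Lc (M) (fun _ => ctrOff (d + 1) Lc) (fun _ => hc) (n + 1) (wrapPt (M) (z + v)) : ↥(pbox (towerTorus Lc (M) (n + 1)))) : Site (d + 1))
      = φ e ((itRoot Lc (fine Lc M) (fun _ => ctrOff (d + 1) Lc) (fun _ => hc) n (wrapPt (fine Lc M) ((Lc : ℤ) • z + toSite (ctrOff (d + 1) Lc) + (Lc : ℤ) • v)) : ↥(pbox (towerTorus Lc (fine Lc M) n))) : Site (d + 1)) := by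
  rw [itRoot_wrapPt_succ, smul_add, add_right_comm]

omit [NeZero Lc] in
/-- the storey potentials are periodic for the top torus (`wrapPt_translate`). -/
theorem itRootPot_translate (hc : ctrOff (d + 1) Lc ∈ box (d + 1) Lc) (M : Fin (d + 1) → ℕ) [∀ μ, NeZero (M μ)] (n : ℕ) {γ : Type*}
    (φ : γ → Site (d + 1) → ℝ) (e : γ) (z m : Site (d + 1)) :
    φ e ((itRoot Lc (M) (fun _ => ctrOff (d + 1) Lc) (fun _ => hc) n (wrapPt (M) (translate M z m)) : ↥(pbox (towerTorus Lc (M) n))) : Site (d + 1))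
      = φ e ((itRoot Lc (M) (fun _ => ctrOff (d + 1) Lc) (fun _ => hc) n (wrapPt (M) z) : ↥(pbox (towerTorus Lc (M) n))) : Site (d + 1)) := by
  rw [wrapPt_translate]

omit [NeZero Lc] in
/-- [folklore] the scale bookkeeping: weights `κ k` linked down the tower by `κ k = s (k+1) · κ (k+1)` (`k < n`) from `κ n = 1` have `κ 0 = ∏_{i<n} s (i+1)`. -/
theorem kappa_zero_eq_prod : ∀ (n : ℕ) (s κ : ℕ → ℝ), (∀ k, k < n → κ k = s (k + 1) * κ (k + 1)) → κ n = 1 → κ 0 = ∏ i ∈ range n, s (i + 1)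
  | 0, s, κ, _, hn => by rw [hn, prod_range_zero]
  | n + 1, s, κ, h, hn => by
    rw [h 0 (Nat.succ_pos n), prod_range_succ', zero_add,
      kappa_zero_eq_prod n (fun k => s (k + 1)) (fun k => κ (k + 1)) (fun k hk => h (k + 1) (Nat.succ_lt_succ hk)) hn, mul_comm]

omit [NeZero Lc] in
/-- [folklore] the step's final bookkeeping: once the regrouped remainder's diagonal is cancelled (`h`), only the raw remainder through `(Q P)ᵀ` is left. -/
theorem assembly_cancel {X Y Z γ : Type*} [Fintype X] [Fintype Y] (P : Matrix Y Z ℝ) (Q : Matrix X Y ℝ) (A B R : Matrix X γ ℝ) (c : ℝ)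
    (h : -c • A + B = 0) : Pᵀ * (-c • (Qᵀ * A)) + (Q * P)ᵀ * (B + R) = (Q * P)ᵀ * R := by
  have hB : B = c • A := by
    have h' := (neg_eq_of_add_eq_zero_right h).symm
    rw [neg_smul, neg_neg] at h'
    exact h'
  subst hB
  rw [Matrix.transpose_mul, Matrix.mul_assoc, Matrix.mul_assoc, Matrix.mul_add, Matrix.mul_add]
  simp only [Matrix.mul_smul]
  rw [neg_smul, neg_add_cancel_left]

/-- **[folklore] `compSumSym_transpose_of_antisymm`** — leaf-06's companion sum of an ANTISYMMETRIC companion family is antisymmetric (storey by storey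
`(Pᵀ G P)ᵀ = Pᵀ Gᵀ P`; `compSumSym_succ`, the transport `onTower` is the reducible identity) — the companion-sum half of the door's parity `hH₁t` in
`GradedFormParity.K1t_of_graded`'s pattern. -/
theorem compSumSym_transpose_of_antisymm
    (G : (T : Fin (d + 1) → ℕ) → Matrix (↥(pbox T) × Fin (d + 1)) (↥(pbox T) × Fin (d + 1)) ℝ) (hGt : ∀ T, (G T)ᵀ = -G T) :
    ∀ (n : ℕ) (M : Fin (d + 1) → ℕ) [∀ μ, NeZero (M μ)] (lev : ℕ → ℕ) (rs : ℕ → (Fin (d + 1) → ℕ)),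
      (compSumSym Lc G M lev rs n)ᵀ = -compSumSym Lc G M lev rs n
  | 0, M, _, lev, rs => by rw [compSumSym_zero, Matrix.transpose_zero, neg_zero]
  | n + 1, M, _, lev, rs => by
    rw [compSumSym_succ, Matrix.transpose_add, Matrix.transpose_mul, Matrix.transpose_mul, Matrix.transpose_transpose, hGt, Matrix.neg_mul,
      Matrix.mul_neg, Matrix.mul_assoc, neg_add]
    congr 1
    exact compSumSym_transpose_of_antisymm G hGt n (fine Lc M) (fun k => lev (k + 1)) (fun k => rs (k + 1))

/-! ## §2a The bottom storey alone (depth `0`, no companion): Wilson + Λ halves against potential gradients, (K1) -/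

/-- **[folklore] `tower_a1_row_base`** — depth `0` (the finest torus IS the top `M`; `compSumSym … 0 = 0`): the Wilson half (§3 of `…Potentials`), the bottom Λ
table's reading split (§1 of `…Storeys`, `κ = 1`) and (K1) leave exactly the Λ table's RAW endpoint readings (read at box representatives — the same by periodicity). -/
theorem tower_a1_row_base [NeZero N] (hc : ctrOff (d + 1) Lc ∈ box (d + 1) Lc) (M : Fin (d + 1) → ℕ) [∀ μ, NeZero (M μ)] {Ma0 : Fin (d + 1) → ℕ}
    (hMa0 : ∀ i, M i = Lc * Ma0 i)
    (c0 : Fin (d + 1) → Site (d + 1) → Fin (d + 1) → Site (d + 1) → ℝ) (hc0 : ∀ κ' u μ y, Summable fun m : Site (d + 1) => c0 μ (translate Ma0 y m) κ' u)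
    (w0 κ0 : ℝ) (hκ0 : κ0 = 1) (hb0 : ↥(pbox M) × Fin (d + 1) → ℝ) (ρ : Site (d + 1)) (L : ℕ) [NeZero L] (cW : ℝ)
    {γ : Type*} (φ : γ → Site (d + 1) → ℝ) (hφ : ∀ e z m, φ e (translate M z m) = φ e z)
    (K1 : ∀ v : ↥(pbox (M)) × Fin (d + 1),
      cW * ((perF (M) (bhKStepAt d ρ L 0)).submatrix
          (fun b : ↥(pbox (M)) × Fin (d + 1) => ((b.1, Sum.inl b.2) : Idx (M) (Fib d)))
          (fun b : ↥(pbox (M)) × Fin (d + 1) => ((b.1, Sum.inl b.2) : Idx (M) (Fib d)))).mulVec hb0 v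
        = w0 * ∑ ā : ↥(pbox (M)) × Fin (d + 1), hb0 ā *
            ∑ μ : Fin (d + 1), ∑' y : Site (d + 1), (∑' m : Site (d + 1), c0 μ (translate (Ma0) y m) ā.2 (ā.1 : Site (d + 1)))
              * symLinKerAt (toSite (ctrOff (d + 1) Lc)) Lc μ y (v.2, (v.1 : Site (d + 1)))) :
    (((-2 * cW) • ∑ b : ↥(pbox (M)) × Fin (d + 1), hb0 b •
          (perF (M) (dper (M) (wilsonA d b.2 (b.1 : Site (d + 1))))).submatrix
            (fun b : ↥(pbox (M)) × Fin (d + 1) => ((b.1, Sum.inl b.2) : Idx (M) (Fib d)))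
            (fun b : ↥(pbox (M)) × Fin (d + 1) => ((b.1, Sum.inl b.2) : Idx (M) (Fib d))))
        + w0 • ∑ ā : ↥(pbox (M)) × Fin (d + 1), hb0 ā •
            (perF (M) (dper (M) (SLam N (c0) (fun μ y => symHessFFAt (toSite (ctrOff (d + 1) Lc)) Lc μ y) ā.2 (ā.1 : Site (d + 1))))).submatrix
              (fun b : ↥(pbox (M)) × Fin (d + 1) => ((b.1, Sum.inl b.2) : Idx (M) (Fib d)))
              (fun b : ↥(pbox (M)) × Fin (d + 1) => ((b.1, Sum.inl b.2) : Idx (M) (Fib d)))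
        + (0 : Matrix (↥(pbox (M)) × Fin (d + 1)) (↥(pbox (M)) × Fin (d + 1)) ℝ))
        * Matrix.of (fun (v : ↥(pbox (M)) × Fin (d + 1)) (e : γ) =>
            φ e ((v.1 : Site (d + 1)) + unitVec v.2) - φ e (v.1 : Site (d + 1)))
      + (perF (M) (bhKStepAt d ρ L 0)).submatrix
          (fun b : ↥(pbox (M)) × Fin (d + 1) => ((b.1, Sum.inl b.2) : Idx (M) (Fib d)))
          (fun b : ↥(pbox (M)) × Fin (d + 1) => ((b.1, Sum.inl b.2) : Idx (M) (Fib d)))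
        * Matrix.of (fun (b : ↥(pbox (M)) × Fin (d + 1)) (e : γ) =>
            -(cW * hb0 b * φ e ((b.1 : Site (d + 1)) + unitVec b.2)))
      = (1 : Matrix (↥(pbox (M)) × Fin (d + 1)) (↥(pbox (M)) × Fin (d + 1)) ℝ)ᵀ * Matrix.of (fun (a : ↥(pbox (M)) × Fin (d + 1)) (e : γ) =>
          -(w0 * κ0 * ∑ ā : ↥(pbox (M)) × Fin (d + 1), hb0 ā *
            ∑ μ : Fin (d + 1), ∑' y : Site (d + 1), (∑' m : Site (d + 1), c0 μ (translate Ma0 y m) ā.2 (ā.1 : Site (d + 1)))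
              * ((φ e ((itRoot Lc (M) (fun _ => ctrOff (d + 1) Lc) (fun _ => hc) 0 (wrapPt (M) ((Lc : ℤ) • y + toSite (ctrOff (d + 1) Lc))) : ↥(pbox (towerTorus Lc (M) 0))) : Site (d + 1))
                    + φ e ((itRoot Lc (M) (fun _ => ctrOff (d + 1) Lc) (fun _ => hc) 0 (wrapPt (M) ((Lc : ℤ) • y + toSite (ctrOff (d + 1) Lc) + (Lc : ℤ) • unitVec μ)) : ↥(pbox (towerTorus Lc (M) 0))) : Site (d + 1)))
                  * symLinKerAt (toSite (ctrOff (d + 1) Lc)) Lc μ y (a.2, (a.1 : Site (d + 1))) / 2))) := by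
  have hW := torus_a1_wilson_potentials M ρ L cW hb0 φ hφ (H₀ := (perF (M) (bhKStepAt d ρ L 0)).submatrix
          (fun b : ↥(pbox (M)) × Fin (d + 1) => ((b.1, Sum.inl b.2) : Idx (M) (Fib d)))
          (fun b : ↥(pbox (M)) × Fin (d + 1) => ((b.1, Sum.inl b.2) : Idx (M) (Fib d)))) rfl
    (W₀ := Matrix.of (fun (v : ↥(pbox (M)) × Fin (d + 1)) (e : γ) =>
            φ e ((v.1 : Site (d + 1)) + unitVec v.2) - φ e (v.1 : Site (d + 1)))) rfl
    (W₁ := Matrix.of (fun (b : ↥(pbox (M)) × Fin (d + 1)) (e : γ) =>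
            -(cW * hb0 b * φ e ((b.1 : Site (d + 1)) + unitVec b.2)))) rfl
  have hL := torus_lamFamily_mul_grad_potentials_split Lc (N := N) M hMa0 c0 hc0 w0 1 hb0
    (G := w0 • ∑ ā : ↥(pbox (M)) × Fin (d + 1), hb0 ā •
            (perF (M) (dper (M) (SLam N (c0) (fun μ y => symHessFFAt (toSite (ctrOff (d + 1) Lc)) Lc μ y) ā.2 (ā.1 : Site (d + 1))))).submatrix
              (fun b : ↥(pbox (M)) × Fin (d + 1) => ((b.1, Sum.inl b.2) : Idx (M) (Fib d)))
              (fun b : ↥(pbox (M)) × Fin (d + 1) => ((b.1, Sum.inl b.2) : Idx (M) (Fib d)))) rfl φ hφ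
    (D := Matrix.of (fun (v : ↥(pbox (M)) × Fin (d + 1)) (e : γ) =>
            φ e ((v.1 : Site (d + 1)) + unitVec v.2) - φ e (v.1 : Site (d + 1))))
    (by rw [one_smul])
  rw [add_zero, Matrix.add_mul, add_right_comm, hW, hL, Matrix.transpose_one, Matrix.one_mul, hκ0]
  ext v e
  simp only [Matrix.add_apply, Matrix.smul_apply, Matrix.of_apply, smul_eq_mul, itRoot_zero, apply_wrapPt_of_periodic M (hφ e)]
  linear_combination (-(φ e (v.1 : Site (d + 1)) + φ e ((v.1 : Site (d + 1)) + unitVec v.2)) / 2) * K1 v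

/-! ## §2b The induction step (top peel): the tower below `fine Lc M` + the top step + the top companion -/

/-- **[folklore] `tower_a1_row_step`** — from the identity for the depth-`n` tower over `fine Lc M` (hypothesis `ih`, the lower storeys' data; companion sum
`compSumSym Lc G (fine Lc M) …`), the identity for the depth-`(n+1)` tower over `M`, spelled top-peeled (`compSumSym_succ`, `compRowsSym_succ` are `rfl`; leaf-06's
`onTower` transport is the reducible identity): the IH's top remainder REGROUPS through the literal top rows `QstepSym Lc M (lev 1)`; the top companion `G M`, identified
with the top storey's Λ-family by `hG0`, reads the composite covariance image of the columns (scale `κ 0`) as «diagonal + raw remainder» at the depth-`(n+1)` storey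
potentials; (LINK 0) cancels the diagonal against the regrouped IH remainder; the raw remainder is the new right-hand side. -/
theorem tower_a1_row_step (hc : ctrOff (d + 1) Lc ∈ box (d + 1) Lc) [NeZero N] (n : ℕ) (M : Fin (d + 1) → ℕ) [∀ μ, NeZero (M μ)]
    (lev : ℕ → ℕ) (rs : ℕ → (Fin (d + 1) → ℕ)) (Ma : ℕ → (Fin (d + 1) → ℕ)) (hMa : ∀ k i, towerTorus Lc M k i = Lc * Ma k i)
    (cf : ℕ → (Fin (d + 1) → Site (d + 1) → Fin (d + 1) → Site (d + 1) → ℝ))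
    (hcf : ∀ k κ' u μ y, Summable fun m : Site (d + 1) => cf k μ (translate (Ma k) y m) κ' u)
    (w κ : ℕ → ℝ) (hκ : ∀ k, k < n + 1 → κ k = stepScale d Lc (lev (k + 1)) * ((box (d + 1) Lc).card : ℝ) * κ (k + 1)) (hκn : κ (n + 1) = 1)
    (hb : (k : ℕ) → (↥(pbox (towerTorus Lc M k)) × Fin (d + 1) → ℝ))
    (G : (T : Fin (d + 1) → ℕ) → Matrix (↥(pbox T) × Fin (d + 1)) (↥(pbox T) × Fin (d + 1)) ℝ)
    (hG0 : G M = w 0 • ∑ ā : ↥(pbox (M)) × Fin (d + 1), hb 0 ā •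
            (perF (M) (dper (M) (SLam N (cf 0) (fun μ y => symHessFFAt (toSite (ctrOff (d + 1) Lc)) Lc μ y) ā.2 (ā.1 : Site (d + 1))))).submatrix
              (fun b : ↥(pbox (M)) × Fin (d + 1) => ((b.1, Sum.inl b.2) : Idx (M) (Fib d)))
              (fun b : ↥(pbox (M)) × Fin (d + 1) => ((b.1, Sum.inl b.2) : Idx (M) (Fib d))))
    (ρ : Site (d + 1)) (L : ℕ) [NeZero L] (cW : ℝ)
    {γ : Type*} (φ : γ → Site (d + 1) → ℝ) (hφ : ∀ e z m, φ e (translate (towerTorus Lc (fine Lc M) n) z m) = φ e z)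
    (hlink : ∀ k, k < n + 1 → ∀ a : ↥(pbox (towerTorus Lc M k)) × Fin (d + 1),
      w k * κ k * (∑ ā : ↥(pbox (towerTorus Lc M k)) × Fin (d + 1), hb k ā *
            ∑ μ : Fin (d + 1), ∑' y : Site (d + 1), (∑' m : Site (d + 1), cf k μ (translate (Ma k) y m) ā.2 (ā.1 : Site (d + 1)))
              * symLinKerAt (toSite (ctrOff (d + 1) Lc)) Lc μ y (a.2, (a.1 : Site (d + 1))))
        = w (k + 1) * κ (k + 1) / (stepScale d Lc (lev (k + 1)) * (Lc : ℝ) ^ (d + 1)) *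
          ∑ ā : ↥(pbox (towerTorus Lc M (k + 1))) × Fin (d + 1), hb (k + 1) ā *
            ∑' m : Site (d + 1), cf (k + 1) a.2 (translate (towerTorus Lc M k) (a.1 : Site (d + 1)) m) ā.2 (ā.1 : Site (d + 1)))
    (ih : (((-2 * cW) • ∑ b : ↥(pbox (towerTorus Lc (fine Lc M) n)) × Fin (d + 1), hb (n + 1) b •
          (perF (towerTorus Lc (fine Lc M) n) (dper (towerTorus Lc (fine Lc M) n) (wilsonA d b.2 (b.1 : Site (d + 1))))).submatrix
            (fun b : ↥(pbox (towerTorus Lc (fine Lc M) n)) × Fin (d + 1) => ((b.1, Sum.inl b.2) : Idx (towerTorus Lc (fine Lc M) n) (Fib d)))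
            (fun b : ↥(pbox (towerTorus Lc (fine Lc M) n)) × Fin (d + 1) => ((b.1, Sum.inl b.2) : Idx (towerTorus Lc (fine Lc M) n) (Fib d))))
          + w (n + 1) • ∑ ā : ↥(pbox (towerTorus Lc (fine Lc M) n)) × Fin (d + 1), hb (n + 1) ā •
            (perF (towerTorus Lc (fine Lc M) n) (dper (towerTorus Lc (fine Lc M) n) (SLam N (cf (n + 1)) (fun μ y => symHessFFAt (toSite (ctrOff (d + 1) Lc)) Lc μ y) ā.2 (ā.1 : Site (d + 1))))).submatrix
              (fun b : ↥(pbox (towerTorus Lc (fine Lc M) n)) × Fin (d + 1) => ((b.1, Sum.inl b.2) : Idx (towerTorus Lc (fine Lc M) n) (Fib d)))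
              (fun b : ↥(pbox (towerTorus Lc (fine Lc M) n)) × Fin (d + 1) => ((b.1, Sum.inl b.2) : Idx (towerTorus Lc (fine Lc M) n) (Fib d)))
          + compSumSym Lc G (fine Lc M) (fun k => lev (k + 1)) (fun k => rs (k + 1)) n)
          * Matrix.of (fun (v : ↥(pbox (towerTorus Lc (fine Lc M) n)) × Fin (d + 1)) (e : γ) =>
            φ e ((v.1 : Site (d + 1)) + unitVec v.2) - φ e (v.1 : Site (d + 1)))
        + (perF (towerTorus Lc (fine Lc M) n) (bhKStepAt d ρ L 0)).submatrix
          (fun b : ↥(pbox (towerTorus Lc (fine Lc M) n)) × Fin (d + 1) => ((b.1, Sum.inl b.2) : Idx (towerTorus Lc (fine Lc M) n) (Fib d)))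
          (fun b : ↥(pbox (towerTorus Lc (fine Lc M) n)) × Fin (d + 1) => ((b.1, Sum.inl b.2) : Idx (towerTorus Lc (fine Lc M) n) (Fib d)))
          * Matrix.of (fun (b : ↥(pbox (towerTorus Lc (fine Lc M) n)) × Fin (d + 1)) (e : γ) =>
            -(cW * hb (n + 1) b * φ e ((b.1 : Site (d + 1)) + unitVec b.2)))
      = (compRowsSym Lc (fine Lc M) (fun k => lev (k + 1)) (fun k => rs (k + 1)) n)ᵀ
          * Matrix.of (fun (a : ↥(pbox (fine Lc M)) × Fin (d + 1)) (e : γ) =>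
          -(w 1 * κ 1 * ∑ ā : ↥(pbox (fine Lc M)) × Fin (d + 1), hb 1 ā *
            ∑ μ : Fin (d + 1), ∑' y : Site (d + 1), (∑' m : Site (d + 1), cf 1 μ (translate (Ma 1) y m) ā.2 (ā.1 : Site (d + 1)))
              * ((φ e ((itRoot Lc (fine Lc M) (fun _ => ctrOff (d + 1) Lc) (fun _ => hc) n (wrapPt (fine Lc M) ((Lc : ℤ) • y + toSite (ctrOff (d + 1) Lc))) : ↥(pbox (towerTorus Lc (fine Lc M) n))) : Site (d + 1))
                    + φ e ((itRoot Lc (fine Lc M) (fun _ => ctrOff (d + 1) Lc) (fun _ => hc) n (wrapPt (fine Lc M) ((Lc : ℤ) • y + toSite (ctrOff (d + 1) Lc) + (Lc : ℤ) • unitVec μ)) : ↥(pbox (towerTorus Lc (fine Lc M) n))) : Site (d + 1)))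
                  * symLinKerAt (toSite (ctrOff (d + 1) Lc)) Lc μ y (a.2, (a.1 : Site (d + 1))) / 2)))) :
    (((-2 * cW) • ∑ b : ↥(pbox (towerTorus Lc (fine Lc M) n)) × Fin (d + 1), hb (n + 1) b •
          (perF (towerTorus Lc (fine Lc M) n) (dper (towerTorus Lc (fine Lc M) n) (wilsonA d b.2 (b.1 : Site (d + 1))))).submatrix
            (fun b : ↥(pbox (towerTorus Lc (fine Lc M) n)) × Fin (d + 1) => ((b.1, Sum.inl b.2) : Idx (towerTorus Lc (fine Lc M) n) (Fib d)))
            (fun b : ↥(pbox (towerTorus Lc (fine Lc M) n)) × Fin (d + 1) => ((b.1, Sum.inl b.2) : Idx (towerTorus Lc (fine Lc M) n) (Fib d))))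
        + w (n + 1) • ∑ ā : ↥(pbox (towerTorus Lc (fine Lc M) n)) × Fin (d + 1), hb (n + 1) ā •
            (perF (towerTorus Lc (fine Lc M) n) (dper (towerTorus Lc (fine Lc M) n) (SLam N (cf (n + 1)) (fun μ y => symHessFFAt (toSite (ctrOff (d + 1) Lc)) Lc μ y) ā.2 (ā.1 : Site (d + 1))))).submatrix
              (fun b : ↥(pbox (towerTorus Lc (fine Lc M) n)) × Fin (d + 1) => ((b.1, Sum.inl b.2) : Idx (towerTorus Lc (fine Lc M) n) (Fib d)))
              (fun b : ↥(pbox (towerTorus Lc (fine Lc M) n)) × Fin (d + 1) => ((b.1, Sum.inl b.2) : Idx (towerTorus Lc (fine Lc M) n) (Fib d)))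
        + (compSumSym Lc G (fine Lc M) (fun k => lev (k + 1)) (fun k => rs (k + 1)) n
            + (QstepSym Lc M (lev 1) * compRowsSym Lc (fine Lc M) (fun k => lev (k + 1)) (fun k => rs (k + 1)) n)ᵀ * G M
              * (QstepSym Lc M (lev 1) * compRowsSym Lc (fine Lc M) (fun k => lev (k + 1)) (fun k => rs (k + 1)) n)))
        * Matrix.of (fun (v : ↥(pbox (towerTorus Lc (fine Lc M) n)) × Fin (d + 1)) (e : γ) =>
            φ e ((v.1 : Site (d + 1)) + unitVec v.2) - φ e (v.1 : Site (d + 1)))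
      + (perF (towerTorus Lc (fine Lc M) n) (bhKStepAt d ρ L 0)).submatrix
          (fun b : ↥(pbox (towerTorus Lc (fine Lc M) n)) × Fin (d + 1) => ((b.1, Sum.inl b.2) : Idx (towerTorus Lc (fine Lc M) n) (Fib d)))
          (fun b : ↥(pbox (towerTorus Lc (fine Lc M) n)) × Fin (d + 1) => ((b.1, Sum.inl b.2) : Idx (towerTorus Lc (fine Lc M) n) (Fib d)))
        * Matrix.of (fun (b : ↥(pbox (towerTorus Lc (fine Lc M) n)) × Fin (d + 1)) (e : γ) =>
            -(cW * hb (n + 1) b * φ e ((b.1 : Site (d + 1)) + unitVec b.2)))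
      = (QstepSym Lc M (lev 1) * compRowsSym Lc (fine Lc M) (fun k => lev (k + 1)) (fun k => rs (k + 1)) n)ᵀ * Matrix.of (fun (a : ↥(pbox (M)) × Fin (d + 1)) (e : γ) =>
          -(w 0 * κ 0 * ∑ ā : ↥(pbox (M)) × Fin (d + 1), hb 0 ā *
            ∑ μ : Fin (d + 1), ∑' y : Site (d + 1), (∑' m : Site (d + 1), cf 0 μ (translate (Ma 0) y m) ā.2 (ā.1 : Site (d + 1)))
              * ((φ e ((itRoot Lc (M) (fun _ => ctrOff (d + 1) Lc) (fun _ => hc) (n + 1) (wrapPt (M) ((Lc : ℤ) • y + toSite (ctrOff (d + 1) Lc))) : ↥(pbox (towerTorus Lc (M) (n + 1)))) : Site (d + 1))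
                    + φ e ((itRoot Lc (M) (fun _ => ctrOff (d + 1) Lc) (fun _ => hc) (n + 1) (wrapPt (M) ((Lc : ℤ) • y + toSite (ctrOff (d + 1) Lc) + (Lc : ℤ) • unitVec μ)) : ↥(pbox (towerTorus Lc (M) (n + 1)))) : Site (d + 1)))
                  * symLinKerAt (toSite (ctrOff (d + 1) Lc)) Lc μ y (a.2, (a.1 : Site (d + 1))) / 2))) := by
  -- `Ma 1 = M`
  have hMa1 : Ma 1 = M := funext fun i =>
    Nat.eq_of_mul_eq_mul_left (Nat.pos_of_ne_zero (NeZero.ne Lc)) (((hMa 1 i).symm.trans (towerTorus_apply Lc M 1 i)).trans (by ring))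
  -- the scale at the top
  have hκ0 : κ 0 = ∏ i ∈ range (n + 1), (stepScale d Lc (lev (i + 1)) * ((box (d + 1) Lc).card : ℝ)) :=
    kappa_zero_eq_prod (n + 1) (fun j => stepScale d Lc (lev j) * ((box (d + 1) Lc).card : ℝ)) κ hκ hκn
  -- the columns are the finest gradient of the potential-value family
  have hW0 : Matrix.of (fun (v : ↥(pbox (towerTorus Lc (fine Lc M) n)) × Fin (d + 1)) (e : γ) =>
            φ e ((v.1 : Site (d + 1)) + unitVec v.2) - φ e (v.1 : Site (d + 1)))
      = (tgrad (towerTorus Lc (fine Lc M) n)).submatrix (fun b : ↥(pbox (towerTorus Lc (fine Lc M) n)) × Fin (d + 1) => ((b.1, Sum.inl b.2) : Idx (towerTorus Lc (fine Lc M) n) (Fib d))) id * (Matrix.of fun (s : ↥(pbox (towerTorus Lc (fine Lc M) n))) (e : γ) => φ e (s : Site (d + 1))) := by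
    rw [tgrad_ff_mul_eq_of_grad]
    ext v e
    simp only [Matrix.of_apply, apply_wrapPt_of_periodic (towerTorus Lc (fine Lc M) n) (hφ e), wrapPt_coe_eq]
  -- the top image of the columns: the composite covariance (leaf-02) + the bridge, scale `κ 0`
  have hcov : (QstepSym Lc M (lev 1) * compRowsSym Lc (fine Lc M) (fun k => lev (k + 1)) (fun k => rs (k + 1)) n) * ((tgrad (towerTorus Lc (fine Lc M) n)).submatrix (fun b : ↥(pbox (towerTorus Lc (fine Lc M) n)) × Fin (d + 1) => ((b.1, Sum.inl b.2) : Idx (towerTorus Lc (fine Lc M) n) (Fib d))) id * (Matrix.of fun (s : ↥(pbox (towerTorus Lc (fine Lc M) n))) (e : γ) => φ e (s : Site (d + 1))))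
      = (∏ i ∈ range (n + 1), (stepScale d Lc (lev (i + 1)) * ((box (d + 1) Lc).card : ℝ))) •
          ((tgrad M).submatrix (fun a : ↥(pbox M) × Fin (d + 1) => ((a.1, Sum.inl a.2) : Idx M (Fib d))) id
            * (Matrix.of fun (s : ↥(pbox (towerTorus Lc (fine Lc M) n))) (e : γ) => φ e (s : Site (d + 1))).submatrix (itRoot Lc M (fun _ => ctrOff (d + 1) Lc) (fun _ => hc) (n + 1)) id) :=
    compRowsSym_mul_tgrad_mul Lc hc (n + 1) M lev rs (Matrix.of fun (s : ↥(pbox (towerTorus Lc (fine Lc M) n))) (e : γ) => φ e (s : Site (d + 1)))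
  have hD : (QstepSym Lc M (lev 1) * compRowsSym Lc (fine Lc M) (fun k => lev (k + 1)) (fun k => rs (k + 1)) n) * Matrix.of (fun (v : ↥(pbox (towerTorus Lc (fine Lc M) n)) × Fin (d + 1)) (e : γ) =>
            φ e ((v.1 : Site (d + 1)) + unitVec v.2) - φ e (v.1 : Site (d + 1)))
      = κ 0 • Matrix.of (fun (a : ↥(pbox M) × Fin (d + 1)) (e : γ) =>
          φ e ((itRoot Lc (M) (fun _ => ctrOff (d + 1) Lc) (fun _ => hc) (n + 1) (wrapPt (M) ((a.1 : Site (d + 1)) + unitVec a.2)) : ↥(pbox (towerTorus Lc (M) (n + 1)))) : Site (d + 1))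
            - φ e ((itRoot Lc (M) (fun _ => ctrOff (d + 1) Lc) (fun _ => hc) (n + 1) (wrapPt (M) (a.1 : Site (d + 1))) : ↥(pbox (towerTorus Lc (M) (n + 1)))) : Site (d + 1))) := by
    rw [hW0, hcov, tgrad_ff_mul_eq_of_grad, hκ0]
    congr 1
  -- the top companion's reading: diagonal + raw remainder, at the depth-(n+1) storey potentials
  have htop := torus_lamFamily_mul_grad_potentials_split Lc (N := N) M (hMa 0) (cf 0) (hcf 0) (w 0) (κ 0) (hb 0) (G := G M) hG0
    (fun (e : γ) (z : Site (d + 1)) => φ e ((itRoot Lc (M) (fun _ => ctrOff (d + 1) Lc) (fun _ => hc) (n + 1) (wrapPt (M) z) : ↥(pbox (towerTorus Lc (M) (n + 1)))) : Site (d + 1))) (itRootPot_translate Lc hc M (n + 1) φ) hD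
  beta_reduce at htop
  -- the IH remainder regrouped through the literal top rows
  have hreg := rawRem_eq_neg_smul_transpose_mul Lc (fine Lc M) (M₂ := M) (fun _ => rfl) (coarsePt M Lc) (coarsePt_coe M Lc) (lev 1)
    (Q := QstepSym Lc M (lev 1)) rfl (cf 1) (w 1) (κ 1) (hb 1) (fun (e : γ) (z : Site (d + 1)) => φ e ((itRoot Lc (fine Lc M) (fun _ => ctrOff (d + 1) Lc) (fun _ => hc) n (wrapPt (fine Lc M) z) : ↥(pbox (towerTorus Lc (fine Lc M) n))) : Site (d + 1))) (itRootPot_translate Lc hc (fine Lc M) n φ)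
  beta_reduce at hreg
  rw [hMa1] at ih
  -- the cancellation at the top: (LINK 0)
  have hcan : -(w 1 * κ 1 / (2 * (stepScale d Lc (lev 1) * (Lc : ℝ) ^ (d + 1)))) •
        Matrix.of (fun (a' : ↥(pbox M) × Fin (d + 1)) (e : γ) =>
          (∑ ā : ↥(pbox (fine Lc M)) × Fin (d + 1), hb 1 ā * ∑' m : Site (d + 1), cf 1 a'.2 (translate M (a'.1 : Site (d + 1)) m) ā.2 (ā.1 : Site (d + 1)))
            * (φ e ((itRoot Lc (fine Lc M) (fun _ => ctrOff (d + 1) Lc) (fun _ => hc) n (wrapPt (fine Lc M) ((Lc : ℤ) • (a'.1 : Site (d + 1)) + toSite (ctrOff (d + 1) Lc))) : ↥(pbox (towerTorus Lc (fine Lc M) n))) : Site (d + 1))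
                + φ e ((itRoot Lc (fine Lc M) (fun _ => ctrOff (d + 1) Lc) (fun _ => hc) n (wrapPt (fine Lc M) ((Lc : ℤ) • (a'.1 : Site (d + 1)) + toSite (ctrOff (d + 1) Lc) + (Lc : ℤ) • unitVec a'.2)) : ↥(pbox (towerTorus Lc (fine Lc M) n))) : Site (d + 1))))
      + Matrix.of (fun (a : ↥(pbox M) × Fin (d + 1)) (e : γ) =>
          w 0 * κ 0 * (∑ ā : ↥(pbox (M)) × Fin (d + 1), hb 0 ā *
            ∑ μ : Fin (d + 1), ∑' y : Site (d + 1), (∑' m : Site (d + 1), cf 0 μ (translate (Ma 0) y m) ā.2 (ā.1 : Site (d + 1)))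
              * symLinKerAt (toSite (ctrOff (d + 1) Lc)) Lc μ y (a.2, (a.1 : Site (d + 1))))
            * ((φ e ((itRoot Lc (M) (fun _ => ctrOff (d + 1) Lc) (fun _ => hc) (n + 1) (wrapPt (M) (a.1 : Site (d + 1))) : ↥(pbox (towerTorus Lc (M) (n + 1)))) : Site (d + 1)) + φ e ((itRoot Lc (M) (fun _ => ctrOff (d + 1) Lc) (fun _ => hc) (n + 1) (wrapPt (M) ((a.1 : Site (d + 1)) + unitVec a.2)) : ↥(pbox (towerTorus Lc (M) (n + 1)))) : Site (d + 1))) / 2)) = 0 := by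
    ext a e
    have hl : w 0 * κ 0 * (∑ ā : ↥(pbox (M)) × Fin (d + 1), hb 0 ā *
            ∑ μ : Fin (d + 1), ∑' y : Site (d + 1), (∑' m : Site (d + 1), cf 0 μ (translate (Ma 0) y m) ā.2 (ā.1 : Site (d + 1)))
              * symLinKerAt (toSite (ctrOff (d + 1) Lc)) Lc μ y (a.2, (a.1 : Site (d + 1))))
          = w 1 * κ 1 / (stepScale d Lc (lev 1) * (Lc : ℝ) ^ (d + 1)) *
            ∑ ā : ↥(pbox (fine Lc M)) × Fin (d + 1), hb 1 ā *
              ∑' m : Site (d + 1), cf 1 a.2 (translate M (a.1 : Site (d + 1)) m) ā.2 (ā.1 : Site (d + 1)) :=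
      hlink 0 (Nat.succ_pos n) a
    simp only [Matrix.add_apply, Matrix.smul_apply, Matrix.of_apply, Matrix.zero_apply, smul_eq_mul]
    rw [itRootPot_succ_add Lc hc M n φ e (a.1 : Site (d + 1)) (unitVec a.2), itRootPot_succ Lc hc M n φ e (a.1 : Site (d + 1))]
    linear_combination ((φ e ((itRoot Lc (fine Lc M) (fun _ => ctrOff (d + 1) Lc) (fun _ => hc) n (wrapPt (fine Lc M) ((Lc : ℤ) • (a.1 : Site (d + 1)) + toSite (ctrOff (d + 1) Lc))) : ↥(pbox (towerTorus Lc (fine Lc M) n))) : Site (d + 1))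
        + φ e ((itRoot Lc (fine Lc M) (fun _ => ctrOff (d + 1) Lc) (fun _ => hc) n (wrapPt (fine Lc M) ((Lc : ℤ) • (a.1 : Site (d + 1)) + toSite (ctrOff (d + 1) Lc) + (Lc : ℤ) • unitVec a.2)) : ↥(pbox (towerTorus Lc (fine Lc M) n))) : Site (d + 1))) / 2) * hl
  -- assembly
  have e1 : (((-2 * cW) • ∑ b : ↥(pbox (towerTorus Lc (fine Lc M) n)) × Fin (d + 1), hb (n + 1) b •
          (perF (towerTorus Lc (fine Lc M) n) (dper (towerTorus Lc (fine Lc M) n) (wilsonA d b.2 (b.1 : Site (d + 1))))).submatrix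
            (fun b : ↥(pbox (towerTorus Lc (fine Lc M) n)) × Fin (d + 1) => ((b.1, Sum.inl b.2) : Idx (towerTorus Lc (fine Lc M) n) (Fib d)))
            (fun b : ↥(pbox (towerTorus Lc (fine Lc M) n)) × Fin (d + 1) => ((b.1, Sum.inl b.2) : Idx (towerTorus Lc (fine Lc M) n) (Fib d))))
          + w (n + 1) • ∑ ā : ↥(pbox (towerTorus Lc (fine Lc M) n)) × Fin (d + 1), hb (n + 1) ā •
            (perF (towerTorus Lc (fine Lc M) n) (dper (towerTorus Lc (fine Lc M) n) (SLam N (cf (n + 1)) (fun μ y => symHessFFAt (toSite (ctrOff (d + 1) Lc)) Lc μ y) ā.2 (ā.1 : Site (d + 1))))).submatrix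
              (fun b : ↥(pbox (towerTorus Lc (fine Lc M) n)) × Fin (d + 1) => ((b.1, Sum.inl b.2) : Idx (towerTorus Lc (fine Lc M) n) (Fib d)))
              (fun b : ↥(pbox (towerTorus Lc (fine Lc M) n)) × Fin (d + 1) => ((b.1, Sum.inl b.2) : Idx (towerTorus Lc (fine Lc M) n) (Fib d)))
          + (compSumSym Lc G (fine Lc M) (fun k => lev (k + 1)) (fun k => rs (k + 1)) n
              + (QstepSym Lc M (lev 1) * compRowsSym Lc (fine Lc M) (fun k => lev (k + 1)) (fun k => rs (k + 1)) n)ᵀ * G M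
                * (QstepSym Lc M (lev 1) * compRowsSym Lc (fine Lc M) (fun k => lev (k + 1)) (fun k => rs (k + 1)) n)))
          * Matrix.of (fun (v : ↥(pbox (towerTorus Lc (fine Lc M) n)) × Fin (d + 1)) (e : γ) =>
            φ e ((v.1 : Site (d + 1)) + unitVec v.2) - φ e (v.1 : Site (d + 1)))
      = (((-2 * cW) • ∑ b : ↥(pbox (towerTorus Lc (fine Lc M) n)) × Fin (d + 1), hb (n + 1) b •
          (perF (towerTorus Lc (fine Lc M) n) (dper (towerTorus Lc (fine Lc M) n) (wilsonA d b.2 (b.1 : Site (d + 1))))).submatrix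
            (fun b : ↥(pbox (towerTorus Lc (fine Lc M) n)) × Fin (d + 1) => ((b.1, Sum.inl b.2) : Idx (towerTorus Lc (fine Lc M) n) (Fib d)))
            (fun b : ↥(pbox (towerTorus Lc (fine Lc M) n)) × Fin (d + 1) => ((b.1, Sum.inl b.2) : Idx (towerTorus Lc (fine Lc M) n) (Fib d))))
          + w (n + 1) • ∑ ā : ↥(pbox (towerTorus Lc (fine Lc M) n)) × Fin (d + 1), hb (n + 1) ā •
            (perF (towerTorus Lc (fine Lc M) n) (dper (towerTorus Lc (fine Lc M) n) (SLam N (cf (n + 1)) (fun μ y => symHessFFAt (toSite (ctrOff (d + 1) Lc)) Lc μ y) ā.2 (ā.1 : Site (d + 1))))).submatrix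
              (fun b : ↥(pbox (towerTorus Lc (fine Lc M) n)) × Fin (d + 1) => ((b.1, Sum.inl b.2) : Idx (towerTorus Lc (fine Lc M) n) (Fib d)))
              (fun b : ↥(pbox (towerTorus Lc (fine Lc M) n)) × Fin (d + 1) => ((b.1, Sum.inl b.2) : Idx (towerTorus Lc (fine Lc M) n) (Fib d)))
          + compSumSym Lc G (fine Lc M) (fun k => lev (k + 1)) (fun k => rs (k + 1)) n)
          * Matrix.of (fun (v : ↥(pbox (towerTorus Lc (fine Lc M) n)) × Fin (d + 1)) (e : γ) =>
            φ e ((v.1 : Site (d + 1)) + unitVec v.2) - φ e (v.1 : Site (d + 1)))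
        + (QstepSym Lc M (lev 1) * compRowsSym Lc (fine Lc M) (fun k => lev (k + 1)) (fun k => rs (k + 1)) n)ᵀ * (G M
            * ((QstepSym Lc M (lev 1) * compRowsSym Lc (fine Lc M) (fun k => lev (k + 1)) (fun k => rs (k + 1)) n)
              * Matrix.of (fun (v : ↥(pbox (towerTorus Lc (fine Lc M) n)) × Fin (d + 1)) (e : γ) =>
            φ e ((v.1 : Site (d + 1)) + unitVec v.2) - φ e (v.1 : Site (d + 1))))) := by
    rw [← add_assoc, Matrix.add_mul, Matrix.mul_assoc, Matrix.mul_assoc]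
  rw [e1, add_right_comm, ih, hreg, htop]
  exact assembly_cancel _ _ _ _ _ _ hcan

end Summit.QuantumFields.BalabanUV.Beta.FP.PeriodisedWardOrderOneTowerStep

end
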